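import Summits.AtomisticToContinuum.Crystallization.Theorems.ChartedZeroExcessLayeredLatticeLiouvilleZZZYRCZY
import Summits.AtomisticToContinuum.Crystallization.Theorems.ChartedZeroExcessLayeredLatticeLiouvilleZZZYRCZP
import Summits.AtomisticToContinuum.Crystallization.Theorems.ChartedZeroExcessLayeredLatticeLiouvilleZZZYRCVP
import Summits.AtomisticToContinuum.Crystallization.Theorems.ChartedZeroExcessLayeredLatticeLiouvilleZZZYRCH

/-!
# Charted zero-excess layered-lattice Liouville — ZZZYRCZZ: the HOLLOW-CELL K-FILE TEMPLATE (one theorem per letter-function box)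

Cell `decomp-a2c`, lens 2 («special vs generic»), generation 100.  Line (D) TAIL-DEBIT of `UniformEquilStabilityAt`; door of record
`uniformEquilStabilityAt_of_atlasW_hollow` (ZZZYRCZX) over hollow shape cells `InBoxWH s aLo aHi τ hLo hHi`.  This file assembles, for ONE
such cell, its `htail` obligation `BoxTailDebitP … (InBoxWH …) ΘR ΘN 0` from DECIDED / NUMERIC inputs only — so that a cell K-file is
«instantiate + `decide` + `norm_num`»:
* NEAR (`nearF_of_inBoxWH`): the five-check numerics of the dials (ZZZYRCZO length comparison at `(λ, μ)`, ZZZYRCZP angle comparison at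
  `β`, monotonised to the cell's `(K_∠, η_∠)`), hand-1's per-hollow-type kernel certificates against one table pair `(TRX, TNX)` at dyadic
  exponent `E` (ZZZYRCZY §1), `μ²·P9max ≤ 9ϱ²`, `μ²·lo ≤ 9ϱ²` ⇒ per word of the cell the near path system on `IdealNearF ℓ hi`
  (`ℓ := letterOfWH …`) dominated by the OFFSET TABLES;
* MIDDLE (`midF_of_inBoxWH`): the Ξ slab certificates of `schemeDominatedOnP_middle` (ZZZYRCVP) placed by `middle_hgeoF` (ZZZYRCZY);
* BOX + FAR-FAR AT THE CELL'S OWN CONSTANT `cB` (`boxSchemeP_of_cover3FBox` = ZZZYRCZY `boxSchemeP_of_cover3F` over ZZZYRCZL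
  `boxSchemeP_of_splitBox`; `boxTailDebitP_of_inBoxWH`): `2(1+s)·aHi + ℓ₀ ≤ ϱ` (generator norms, `gen_norm_le_of_slabBoxF`, ZZZYRCZO), the cell's
  co-Lipschitz constant `2cB² ≤ λ²` (`isLayeredCrystal_of_inBoxW`, ZZZYRCZT — the L-cB mechanism of record, memo NODE-g100 §7: the far-far
  remainder is read at `cB`, NOT at the statement's `c₀`, which enters only through `boxTailDebitP_of_scheme`, ZZZYRCH) and the one numeric
  far-far inequality at `cB` ⇒ `BoxSchemeP` ⇒ `BoxTailDebitP … 0`, with WORD-INDEPENDENT tables `ΘR(δ) = nearR δ + midR δ + (1+α)θ`,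
  `ΘN(δ) = nearN δ + midN δ + (1+α⁻¹)θ` of the piece offset `δ`.

Theorem file (4 defs, 5 theorems); imports ZZZYRCZY, ZZZYRCZP, ZZZYRCVP, ZZZYRCH; no instance / notation / option; 0 sorry. [g100]
-/

namespace Summit.AtomisticToContinuum.Crystallization.Theorems.ChartedZeroExcessLayeredLatticeLiouville

open scoped BigOperators RealInnerProductSpace
open Summit.AtomisticToContinuum.Crystallization.Theorems.ChartedPlanarOrderRigidityDoor (E3)

/-! ### §1 the cell's near system and its offset tables -/

/-- the near piece counts of the hollow cell, read off the per-type window data along the cell's letter assignment. [g100] -/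
noncomputable def cellNpF (H₀ : ℕ) (cdOf : List ℤ → List ChordDatum) (s aLo aHi τ hLo hHi : ℝ) (L : E3 ≃L[ℝ] E3) (w' : ℤ → E3) :
    (Cell 2 × ℤ) × (Cell 2 × ℤ) → ℕ :=
  dataNpF H₀ fun m => cdOf (windowWord (letterOfWH s aLo aHi τ hLo hHi L w') (m - H₀) (2 * H₀ + 1))

/-- the near node sequences of the hollow cell. [g100] -/
noncomputable def cellZF (H₀ : ℕ) (cdOf : List ℤ → List ChordDatum) (s aLo aHi τ hLo hHi : ℝ) (L : E3 ≃L[ℝ] E3) (w' : ℤ → E3) :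
    (Cell 2 × ℤ) × (Cell 2 × ℤ) → ℕ → Cell 2 × ℤ :=
  dataZF H₀ fun m => cdOf (windowWord (letterOfWH s aLo aHi τ hLo hHi L w') (m - H₀) (2 * H₀ + 1))

/-- the near R offset table `(1+α)λ⁻⁸·Σ_d TRX(d, δ)/2^E`. [g100] -/
noncomputable def nearTableR (H₀ R E : ℕ) (α lam : ℝ) (TRX : ℤ × ℤ × ℤ × ℤ → ℤ) (δ : Cell 2 × ℤ) : ℝ :=
  (1 + α) * (lam ^ 8)⁻¹ * offsetSumF H₀ R (fun k => (TRX k : ℝ) / 2 ^ E) δ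

/-- the near N offset table `(1+α⁻¹)λ⁻⁸·Σ_d (K_∠·TNX + η_∠·TRX)(d, δ)/2^E`. [g100] -/
noncomputable def nearTableN (H₀ R E : ℕ) (α lam Ka ηa : ℝ) (TRX TNX : ℤ × ℤ × ℤ × ℤ → ℤ) (δ : Cell 2 × ℤ) : ℝ :=
  (1 + α⁻¹) * (lam ^ 8)⁻¹ * offsetSumF H₀ R (fun k => Ka * ((TNX k : ℝ) / 2 ^ E) + ηa * ((TRX k : ℝ) / 2 ^ E)) δ

/-- ★ NEAR, per word of the hollow cell: five-check numerics + per-hollow-type kernel certificates ⇒ the near path system on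
`IdealNearF (letterOfWH …) hi` dominated by the offset tables. [g100] -/
theorem nearF_of_inBoxWH {s aLo aHi τ hLo hHi lam mu β Ka ηa ϱ α : ℝ} {H₀ R E : ℕ} {lo hi P9max : ℤ}
    {cdOf : List ℤ → List ChordDatum} {TRX TNX : ℤ × ℤ × ℤ × ℤ → ℤ}
    (haLo : 0 < aLo) (hs0 : 0 ≤ s) (hs1 : s < 1) (hτ : 0 ≤ τ) (hhLo : 0 ≤ hLo) (hhHi : 0 ≤ hHi)
    (hA : lam ^ 2 < (1 - s) ^ 2 * aLo ^ 2)
    (hAC : (1 - s) ^ 2 * τ ^ 2 * aLo ^ 4 ≤ ((1 - s) ^ 2 * aLo ^ 2 - lam ^ 2) * ((τ ^ 2 + hLo ^ 2) * aLo ^ 2 - 2 / 3 * lam ^ 2))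
    (hC2 : lam ^ 2 * (τ ^ 2 + 2 / 3 * (1 - s) ^ 2) ≤ hLo ^ 2 * (1 - s) ^ 2 * aLo ^ 2) (hA' : (1 + s) ^ 2 * aHi ^ 2 < mu ^ 2)
    (hAC' : (1 + s) ^ 2 * τ ^ 2 * aHi ^ 4 ≤ (mu ^ 2 - (1 + s) ^ 2 * aHi ^ 2) * (2 / 3 * mu ^ 2 - (τ ^ 2 + hHi ^ 2) * aHi ^ 2))
    (hΔ : hLo ≤ hHi) (hhb : 3 * (hLo + hHi) ^ 2 ≤ 8 * (1 + s) ^ 2) (hlam : 0 < lam) (hβ : 0 < β)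
    (hKa : (1 + β) * ((1 + s) * aHi / lam) ^ 2 ≤ Ka) (hηa : 6 * (1 + β⁻¹) * (aHi / lam) ^ 2 * (τ ^ 2 + (hHi - hLo) ^ 2 / 4) ≤ ηa)
    (hϱ : 0 ≤ ϱ) (hα : 0 < α)
    (hT : ∀ ω : List ℤ, ω.length = 2 * H₀ + 1 → IsLetterSeq (regW ω) → IsHollowWindow (2 * H₀ + 1) ω →
      KernelSlabSoundF H₀ R ω lo hi P9max E (cdOf ω) TRX TNX)
    (hP9 : mu ^ 2 * (P9max : ℝ) ≤ 9 * ϱ ^ 2) (hlo : mu ^ 2 * (lo : ℝ) ≤ 9 * ϱ ^ 2) {L : E3 ≃L[ℝ] E3} {w' : ℤ → E3}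
    (hB : InBoxWH s aLo aHi τ hLo hHi L w') :
    IsPathSystemOn ϱ (gen₁ L) (gen₂ L) w' (IdealNearF (letterOfWH s aLo aHi τ hLo hHi L w') hi) (cellNpF H₀ cdOf s aLo aHi τ hLo hHi L w')
        (cellZF H₀ cdOf s aLo aHi τ hLo hHi L w') ∧
      SchemeDominatedOnP ϱ α (gen₁ L) (gen₂ L) w' (cellNpF H₀ cdOf s aLo aHi τ hLo hHi L w') (cellZF H₀ cdOf s aLo aHi τ hLo hHi L w')
        (IdealNearF (letterOfWH s aLo aHi τ hLo hHi L w') hi) (fun y => nearTableR H₀ R E α lam TRX (y.2 - y.1))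
        fun y => nearTableN H₀ R E α lam Ka ηa TRX TNX (y.2 - y.1) := by
  obtain ⟨hℓ, hH, hbox⟩ := letterOfWH_spec hB
  have hL := idealLengthCmpF_of_slabBoxF hbox haLo hs0 hs1 hτ hhLo hhHi hA hAC hC2 hA' hAC'
  have hAng := idealAngleCmpF_mono hKa hηa (idealAngleCmpF_of_slabBoxF hbox hL haLo.le hs0 hΔ hhb hlam hβ)
  have hK0 : 0 ≤ Ka := le_trans (by positivity) hKa
  have hη0 : 0 ≤ ηa := le_trans (by positivity) hηa
  exact thetaReaderNearF_of_types hℓ (fun m => isHollowWindow_windowWord hH _ _) hϱ hα hlam hK0 hη0 hT hL hAng hP9 hlo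

/-! ### §2 the cell's middle domination -/

/-- ★ MIDDLE, per word of the hollow cell: the length numerics of the dials + the Ξ slab certificates ⇒ king-table domination on
`¬ IdealNearF (letterOfWH …) hi ∧ ‖e‖ ≤ D`. [g100] -/
theorem midF_of_inBoxWH {s aLo aHi τ hLo hHi lam mu ϱ α D : ℝ} {hi : ℤ} {Kx HI1 HI2 Gb Mm nr : ℕ} {yLo : ℤ}
    (haLo : 0 < aLo) (hs0 : 0 ≤ s) (hs1 : s < 1) (hτ : 0 ≤ τ) (hhLo : 0 ≤ hLo) (hhHi : 0 ≤ hHi)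
    (hA : lam ^ 2 < (1 - s) ^ 2 * aLo ^ 2)
    (hAC : (1 - s) ^ 2 * τ ^ 2 * aLo ^ 4 ≤ ((1 - s) ^ 2 * aLo ^ 2 - lam ^ 2) * ((τ ^ 2 + hLo ^ 2) * aLo ^ 2 - 2 / 3 * lam ^ 2))
    (hC2 : lam ^ 2 * (τ ^ 2 + 2 / 3 * (1 - s) ^ 2) ≤ hLo ^ 2 * (1 - s) ^ 2 * aLo ^ 2) (hA' : (1 + s) ^ 2 * aHi ^ 2 < mu ^ 2)
    (hAC' : (1 + s) ^ 2 * τ ^ 2 * aHi ^ 4 ≤ (mu ^ 2 - (1 + s) ^ 2 * aHi ^ 2) * (2 / 3 * mu ^ 2 - (τ ^ 2 + hHi ^ 2) * aHi ^ 2))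
    (hlam : 0 < lam) (hα : 0 < α) (hKx : 0 < Kx) (slabs : List (ℤ × List (List (ℕ × ℕ)) × List ℕ))
    (hsl : ∀ sl ∈ slabs, xiSlab Kx HI1 HI2 sl.1 yLo sl.2.1 = some sl.2.2 ∧ ∀ c ∈ sl.2.1, c.length = nr)
    (hG : 4 * HI2 < 3 * (3 * (Gb + 1) - 2) ^ 2) (hM : HI2 < 6 * (Mm + 1) * (Mm + 1))
    (hy : ∀ t : ℤ, t.natAbs ≤ Gb → yLo ≤ t ∧ t < yLo + nr)
    (hx : ∀ t : ℤ, t.natAbs ≤ Gb → ∃ sl ∈ slabs, sl.1 ≤ t ∧ t < sl.1 + sl.2.1.length)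
    (h1 : (HI1 : ℤ) ≤ hi) (h2 : 9 * D ^ 2 ≤ lam ^ 2 * (HI2 : ℝ)) {L : E3 ≃L[ℝ] E3} {w' : ℤ → E3}
    (hB : InBoxWH s aLo aHi τ hLo hHi L w') :
    SchemeDominatedOnP ϱ α (gen₁ L) (gen₂ L) w' kingN kingZ
      (fun x => ¬ IdealNearF (letterOfWH s aLo aHi τ hLo hHi L w') hi x ∧ ‖bondVec (gen₁ L) (gen₂ L) w' x‖ ≤ D)
      (fun y => (1 + α) * (lam ^ 8)⁻¹ * (45927 / Kx * (slabs.map fun sl => (sl.2.2.getD (code3 (y.2 - y.1)) 0 : ℝ)).sum))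
      (fun y => (1 + α⁻¹) * (lam ^ 8)⁻¹ * (45927 / Kx * (slabs.map fun sl => (sl.2.2.getD (code3 (y.2 - y.1)) 0 : ℝ)).sum)) := by
  obtain ⟨hℓ, _, hbox⟩ := letterOfWH_spec hB
  have hL := idealLengthCmpF_of_slabBoxF hbox haLo hs0 hs1 hτ hhLo hhHi hA hAC hC2 hA' hAC'
  exact schemeDominatedOnP_middle hα hlam _ hKx slabs hsl hG hM hy hx (middle_hgeoF hℓ hlam hL h1 h2)

/-! ### §3 the template -/

/-- ★★ THE THREE-WAY F BOX READER AT THE BOX'S CONSTANT (ZZZYRCZY `boxSchemeP_of_cover3F` with `hwB`, over ZZZYRCZL `boxSchemeP_of_splitBox`):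
near reader on `IdealNearF (ℓf L w') hi` + middle king-table domination + `‖gen₁ L‖ + ‖gen₂ L‖ + ℓ₀ ≤ ϱ` + per-word co-Lipschitz at `cB` + the
far-far numeric inequality AT `cB`. [g100] -/
theorem boxSchemeP_of_cover3FBox {s Λ c₀ ℓ₀ ϱ α D θ cB : ℝ} (hα : 0 < α) (hcB : 0 < cB) (hϱ0 : 0 < ϱ) (hD : 0 < D) {nD n₁ : ℕ}
    (hnD : (nD : ℝ) - 1 ≤ D / ϱ) (h2 : 2 ≤ n₁) (hnD₁ : nD ≤ n₁)
    (hθ : ∑ n ∈ Finset.Ico nD n₁, (2 * (n : ℝ) * (n + 1) * (2 * n + 1) / 3) * (7 * (n : ℝ) / D ^ 8) +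
        14 * ((n₁ : ℝ) + 1) * (2 * n₁ + 1) / (9 * cB ^ 8 * (n₁ : ℝ) ^ 2 * ((n₁ : ℝ) - 1) ^ 3) ≤ θ)
    (ℓf : (E3 ≃L[ℝ] E3) → (ℤ → E3) → ℤ → ℤ) (hi : ℤ) {B : (E3 ≃L[ℝ] E3) → (ℤ → E3) → Prop}
    {np₁ : (E3 ≃L[ℝ] E3) → (ℤ → E3) → (Cell 2 × ℤ) × (Cell 2 × ℤ) → ℕ}
    {z₁ : (E3 ≃L[ℝ] E3) → (ℤ → E3) → (Cell 2 × ℤ) × (Cell 2 × ℤ) → ℕ → Cell 2 × ℤ}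
    {ΘR₁ ΘN₁ ΘR₂ ΘN₂ : (E3 ≃L[ℝ] E3) → (ℤ → E3) → (Cell 2 × ℤ) × (Cell 2 × ℤ) → ℝ}
    (hgen : ∀ (L : E3 ≃L[ℝ] E3) (w' : ℤ → E3), B L w' → ‖gen₁ L‖ + ‖gen₂ L‖ + ℓ₀ ≤ ϱ)
    (hwB : ∀ a : ℝ, 0 < a → ∀ (L : E3 ≃L[ℝ] E3) (w' : ℤ → E3), IsAdmissibleWord a s Λ c₀ ℓ₀ L w' → B L w' →
      IsLayeredCrystal cB (gen₁ L) (gen₂ L) w')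
    (hnear : ∀ a : ℝ, 0 < a → ∀ (L : E3 ≃L[ℝ] E3) (w' : ℤ → E3), IsAdmissibleWord a s Λ c₀ ℓ₀ L w' → B L w' →
      IsPathSystemOn ϱ (gen₁ L) (gen₂ L) w' (IdealNearF (ℓf L w') hi) (np₁ L w') (z₁ L w') ∧
        SchemeDominatedOnP ϱ α (gen₁ L) (gen₂ L) w' (np₁ L w') (z₁ L w') (IdealNearF (ℓf L w') hi) (ΘR₁ L w') (ΘN₁ L w'))
    (hmid : ∀ a : ℝ, 0 < a → ∀ (L : E3 ≃L[ℝ] E3) (w' : ℤ → E3), IsAdmissibleWord a s Λ c₀ ℓ₀ L w' → B L w' →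
      SchemeDominatedOnP ϱ α (gen₁ L) (gen₂ L) w' kingN kingZ
        (fun x => ¬ IdealNearF (ℓf L w') hi x ∧ ‖bondVec (gen₁ L) (gen₂ L) w' x‖ ≤ D) (ΘR₂ L w') (ΘN₂ L w')) :
    BoxSchemeP s Λ c₀ ℓ₀ ϱ α B
      (fun L w' => pathSpliceN D (gen₁ L) (gen₂ L) w' (idealSpliceNF (ℓf L w') hi (np₁ L w') kingN) kingN)
      (fun L w' => pathSpliceZ D (gen₁ L) (gen₂ L) w' (idealSpliceZF (ℓf L w') hi (z₁ L w') kingZ) kingZ)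
      (fun L w' y => ΘR₁ L w' y + ΘR₂ L w' y + (1 + α) * θ) (fun L w' y => ΘN₁ L w' y + ΘN₂ L w' y + (1 + α⁻¹) * θ) := by
  refine boxSchemeP_of_splitBox hα hcB hϱ0 hD hnD h2 hnD₁ hθ hgen hwB fun a ha L w' hA hB => ?_
  obtain ⟨hP₁, hS₁⟩ := hnear a ha L w' hA hB
  have hw : IsLayeredCrystal cB (gen₁ L) (gen₂ L) w' := hwB a ha L w' hA hB
  have hlip : ∀ m : ℤ, ‖w' (m + 1) - w' m‖ ≤ ℓ₀ := hA.2.2.2.2.1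
  have hK := isPathSystemOn_of (isPathSystem_king hcB hw hlip (hgen L w' hB))
    (fun x => ¬ IdealNearF (ℓf L w') hi x ∧ ‖bondVec (gen₁ L) (gen₂ L) w' x‖ ≤ D)
  exact ⟨isPathSystemOn_idealCoverF hP₁ hK, schemeDominatedOnP_idealCoverF hS₁ (hmid a ha L w' hA hB)⟩

/-- the generator norms of a hollow cell. [g100] -/
theorem gen_sum_le_of_inBoxWH {s aLo aHi τ hLo hHi ℓ₀ ϱ : ℝ} (haLo : 0 ≤ aLo) (hs0 : 0 ≤ s) (hϱ : 2 * ((1 + s) * aHi) + ℓ₀ ≤ ϱ)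
    {L : E3 ≃L[ℝ] E3} {w' : ℤ → E3} (hB : InBoxWH s aLo aHi τ hLo hHi L w') : ‖gen₁ L‖ + ‖gen₂ L‖ + ℓ₀ ≤ ϱ := by
  obtain ⟨ℓ, _, _, hbox⟩ := hB
  obtain ⟨h₁, h₂⟩ := gen_norm_le_of_slabBoxF hbox haLo hs0
  linarith

/-- ★★★ **THE HOLLOW-CELL K-FILE TEMPLATE**: the `htail` obligation of the door of record for ONE letter-function box, from numerics, the
per-hollow-type kernel certificates, the Ξ slab certificates and the far-far inequality AT THE CELL'S CONSTANT `cB` (`2cB² ≤ λ²`) — with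
word-independent offset tables; the statement's `c₀` is only required positive. [g100] -/
theorem boxTailDebitP_of_inBoxWH {s Λ c₀ ℓ₀ aLo aHi τ hLo hHi lam mu β Ka ηa ϱ α D θ cB : ℝ} {H₀ R E : ℕ} {lo hi P9max : ℤ}
    {cdOf : List ℤ → List ChordDatum} {TRX TNX : ℤ × ℤ × ℤ × ℤ → ℤ} {Kx HI1 HI2 Gb Mm nr nD n₁ : ℕ} {yLo : ℤ}
    (hc : 0 < c₀) (hϱ1 : 1 ≤ ϱ) (hα : 0 < α) (hD : 0 < D) (hcB : 0 < cB) (hcB2 : 2 * cB ^ 2 ≤ lam ^ 2)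
    (haLo : 0 < aLo) (hs0 : 0 ≤ s) (hs1 : s < 1) (hτ : 0 ≤ τ) (hhLo : 0 ≤ hLo) (hhHi : 0 ≤ hHi)
    (hA : lam ^ 2 < (1 - s) ^ 2 * aLo ^ 2)
    (hAC : (1 - s) ^ 2 * τ ^ 2 * aLo ^ 4 ≤ ((1 - s) ^ 2 * aLo ^ 2 - lam ^ 2) * ((τ ^ 2 + hLo ^ 2) * aLo ^ 2 - 2 / 3 * lam ^ 2))
    (hC2 : lam ^ 2 * (τ ^ 2 + 2 / 3 * (1 - s) ^ 2) ≤ hLo ^ 2 * (1 - s) ^ 2 * aLo ^ 2) (hA' : (1 + s) ^ 2 * aHi ^ 2 < mu ^ 2)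
    (hAC' : (1 + s) ^ 2 * τ ^ 2 * aHi ^ 4 ≤ (mu ^ 2 - (1 + s) ^ 2 * aHi ^ 2) * (2 / 3 * mu ^ 2 - (τ ^ 2 + hHi ^ 2) * aHi ^ 2))
    (hΔ : hLo ≤ hHi) (hhb : 3 * (hLo + hHi) ^ 2 ≤ 8 * (1 + s) ^ 2) (hlam : 0 < lam) (hβ : 0 < β)
    (hKa : (1 + β) * ((1 + s) * aHi / lam) ^ 2 ≤ Ka) (hηa : 6 * (1 + β⁻¹) * (aHi / lam) ^ 2 * (τ ^ 2 + (hHi - hLo) ^ 2 / 4) ≤ ηa)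
    (hgen : 2 * ((1 + s) * aHi) + ℓ₀ ≤ ϱ)
    (hT : ∀ ω : List ℤ, ω.length = 2 * H₀ + 1 → IsLetterSeq (regW ω) → IsHollowWindow (2 * H₀ + 1) ω →
      KernelSlabSoundF H₀ R ω lo hi P9max E (cdOf ω) TRX TNX)
    (hP9 : mu ^ 2 * (P9max : ℝ) ≤ 9 * ϱ ^ 2) (hlo : mu ^ 2 * (lo : ℝ) ≤ 9 * ϱ ^ 2)
    (hKx : 0 < Kx) (slabs : List (ℤ × List (List (ℕ × ℕ)) × List ℕ))
    (hsl : ∀ sl ∈ slabs, xiSlab Kx HI1 HI2 sl.1 yLo sl.2.1 = some sl.2.2 ∧ ∀ c ∈ sl.2.1, c.length = nr)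
    (hG : 4 * HI2 < 3 * (3 * (Gb + 1) - 2) ^ 2) (hM : HI2 < 6 * (Mm + 1) * (Mm + 1))
    (hy : ∀ t : ℤ, t.natAbs ≤ Gb → yLo ≤ t ∧ t < yLo + nr)
    (hx : ∀ t : ℤ, t.natAbs ≤ Gb → ∃ sl ∈ slabs, sl.1 ≤ t ∧ t < sl.1 + sl.2.1.length)
    (h1 : (HI1 : ℤ) ≤ hi) (h2 : 9 * D ^ 2 ≤ lam ^ 2 * (HI2 : ℝ))
    (hnD : (nD : ℝ) - 1 ≤ D / ϱ) (hn2 : 2 ≤ n₁) (hnD₁ : nD ≤ n₁)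
    (hθ : ∑ n ∈ Finset.Ico nD n₁, (2 * (n : ℝ) * (n + 1) * (2 * n + 1) / 3) * (7 * (n : ℝ) / D ^ 8) +
        14 * ((n₁ : ℝ) + 1) * (2 * n₁ + 1) / (9 * cB ^ 8 * (n₁ : ℝ) ^ 2 * ((n₁ : ℝ) - 1) ^ 3) ≤ θ) :
    BoxTailDebitP s Λ c₀ ℓ₀ ϱ (InBoxWH s aLo aHi τ hLo hHi)
      (fun _ _ y => nearTableR H₀ R E α lam TRX (y.2 - y.1) +
        (1 + α) * (lam ^ 8)⁻¹ * (45927 / Kx * (slabs.map fun sl => (sl.2.2.getD (code3 (y.2 - y.1)) 0 : ℝ)).sum) + (1 + α) * θ)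
      (fun _ _ y => nearTableN H₀ R E α lam Ka ηa TRX TNX (y.2 - y.1) +
        (1 + α⁻¹) * (lam ^ 8)⁻¹ * (45927 / Kx * (slabs.map fun sl => (sl.2.2.getD (code3 (y.2 - y.1)) 0 : ℝ)).sum) + (1 + α⁻¹) * θ)
      0 := by
  have hϱ0 : 0 < ϱ := one_pos.trans_le hϱ1
  exact boxTailDebitP_of_scheme hϱ1 hα hc
    (boxSchemeP_of_cover3FBox hα hcB hϱ0 hD hnD hn2 hnD₁ hθ (letterOfWH s aLo aHi τ hLo hHi) hi
      (fun L w' hB => gen_sum_le_of_inBoxWH haLo.le hs0 hgen hB)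
      (fun a _ L w' _ hB => isLayeredCrystal_of_inBoxW (inBoxW_of_inBoxWH hB) hcB.le hcB2 haLo hs0 hs1 hτ hhLo hhHi hA hAC hC2
        hA' hAC')
      (fun a _ L w' _ hB => nearF_of_inBoxWH haLo hs0 hs1 hτ hhLo hhHi hA hAC hC2 hA' hAC' hΔ hhb hlam hβ hKa hηa hϱ0.le hα hT
        hP9 hlo hB)
      (fun a _ L w' _ hB => midF_of_inBoxWH (ϱ := ϱ) haLo hs0 hs1 hτ hhLo hhHi hA hAC hC2 hA' hAC' hlam hα hKx slabs hsl hG hM hy hx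
        h1 h2 hB))

end Summit.AtomisticToContinuum.Crystallization.Theorems.ChartedZeroExcessLayeredLatticeLiouville
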